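import Summits.QuantumFields.BalabanUV.T4Continuum.Support.B13AssemblyCoresEnd
import Summits.QuantumFields.BalabanUV.T4Continuum.Support.B13StepEndArithmetic
import Summits.QuantumFields.BalabanUV.T4Continuum.Support.OutputRateWindow

/-!
# NE5 ∕ U3 — THE END OF RECORD WITH (2.14) FACTOR CORES, ARITHMETIC LETTERS ELIMINATED: per instance (`∃ C₅`), η-UNIFORM
# (`∃ C₅, ∀ R S₀ M 𝔠 …`) and WINDOWWISE with g-INDEXED factor letters (R24 × R29′) — row O6-n follower of leaf-08-g3's
# `B13AssemblyCoresEnd` (p218821: the R28∕R32 composition «END OF RECORD WITH (2.14) FACTOR CORES», /7 `termGaussianParamBi_term_of_factors`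
# + /8 `paramMass_termCore_le_actMajorant` ∘ leaf-09-g2's `B13StepEndLoc` faces)

Cell `pub-balaban`, unit `b2b-balaban-t4-ne5-formalise-leaf-10` (NE5 formalisation swarm, LEAF PROVER 10, gen 6; journal INTENT `CLAIMS.log`
l.13329, CLAIM RULE 1 — the N69 pattern of this lineage: `B13StepEndArithmetic` p210647, `B13StepEndArithmeticWindow` p217294,
`B13StepEndSubArithmetic` p218097, `B13StepEndLocArithmetic` p218755).  Summits-side new work under the LEAN PLACEMENT RULE (cell
bookkeeping; NOT a Literature module; 0 `def`, 0 cite tag); nothing landed is edited — leaf-08's two faces, this lineage's letter algebra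
(`reach_elim_iff`, `reach_binders_exists`, `smallness_of_gain`) and the owner's window lemma (`OutputRateWindow.ne5_of_forall_singleton`)
are applied BY NAME.  HONEST FRAMING: rung (B)+1 of the FINITE-VOLUME T⁴ continuum programme — NOT infinite volume, NOT a mass gap, NOT
the Clay problem, and **NOT A PROOF OF NE5** (NOT PRINTED; GAPS G-t4-U3-1): every theorem is an IMPLICATION whose wall binders — the FACTOR
operator letters of the (2.14) cores (`0 < m⋆ ≤ mf`, `0 ≤ wB`, `0 ≤ N₀f`; per localizing tuple and factor `N` a.e.-strongly measurable ∕
holomorphic ∕ `≤ N₀f` and `q` jointly a.e.-s.m. ∕ holomorphic ∕ margin `mf‖v‖² − bf ≤ Re q` on the operator ball — W2-op RELOCATED to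
factor level, GAPS G-ne5p1-1′∕1″, NOT PRINTED; [Balaban1988RG2Cluster] (2.14)–(2.18) pp. 15–16 are locators of KIND only), the per-domain
FACTOR-MASS budget `hmaj` + `TermBudgetLoc a G` ((2.38)–(2.41) KIND), W1 in row NE2's entry currency, W3 slice budgets, W4, the quoted
levels L05∕L06 ([Balaban1987RG1] (1.18) p. 263 — SHAPE only), rooms and the history radius — are DISPLAYED HYPOTHESES, asserted nowhere.
HONEST DEPENDENCY (cell line, verbatim): continuum YM on T⁴ ⇐ BetaPertH ∧ nine spine estimates (0/9 proved); BetaPertH ⇐ (D1) ∧ (D4) ∧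
CAP+tail; G-an2-4 gates asym, D1 and NE2/3/4.

WHAT THIS FILE DOES (compositions BY NAME; no estimate of its own).
* §1 PER INSTANCE — **`exists_ne5_of_assemblyOn_cores`** (leaf-08's §1 `ne5_of_assemblyOn_cores`, assembled step over ANY operator carrier
  `Op`, W1 = `OperatorRate δ θ`) and **`exists_ne5_of_record_onSub_cores`** (leaf-08's §2 `ne5_of_record_onSub_cores`, the slots OF RECORD
  on the sub-slot `M`, cores typed ON `↥M`, W1 from the record's bounded raw suppliers + row NE2's weighted entrywise rate + floor): the
  five arithmetic binders `hρ₀`∕`hnear`∕`hB`∕`hfirst`∕`hsmall` over `ρ₀, k₀, B` (and the idle level letter `E₁`) REPLACED by `0 < θ < 1` and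
  the two strict size inequalities `cA(EA₀ + E₀) < 1 − ω`, `ω + G·cA·(1 − ω)∕(1 − ω − cA(EA₀ + E₀)) < θ′` (`reach_elim_iff` ∕
  `reach_binders_exists` with `D := δ + δ′` resp. `c₁∕r₀ + δ′` ∕ `smallness_of_gain`, `E₁ := 1`); every other binder VERBATIM and in
  leaf-08's order; `∃ C₅` per instance (R29′: terminal for its window without a displayed bound).
* §2 η-UNIFORM — **`uniform_ne5_of_record_onSub_cores`**: `∃ C₅` OUTERMOST — ONE constant from the SIZES `κ, G, EA₀, E₀, cA, cB, c₁, r₀,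
  δ′`, `0 < θ < 1`, `θ ≤ θ′ ≤ 1`, `0 < ω < 1` (two strict size inequalities) for EVERY pair of runs `R`, measurable potential frame `P`,
  slot package `S₀` (`S₀.D.ω = ω`), sub-slot `M ∋` the data of record (of record `↥measOp`), label ∕ parameter ∕ fibre types
  `𝒴, dom, PΛ, V`, CORE FAMILY `𝔠`, factor letters `m⋆, mf, bf, N₀f`, radius bound `H`, mass weights `a`, radii `ROp < R′`, `RHist`
  and window: the displayed binders of `ne5_of_record_onSub_cores` imply
  `NE5 (outA (onSub S₀ M hMA hMB (actOfCores 𝔠)) E₀ cB) (outB (onSub S₀ M hMA hMB (actOfCores 𝔠)) E₀ cB) W κ θ′ C₅`.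
* §3 WINDOWWISE (owner R24 × R29′ (a)) — **`uniform_ne5_of_record_onSub_cores_singleton`**: §2 with every window-dependent binder
  supplied at the singleton window `{g}` for each `g ∈ W`, the factor LETTERS `m⋆ g, mf g, bf g, N₀f g`, the radius bound `H g` and the
  mass weights `a g` g-INDEXED (COMMON budget `G`), the cores `𝔠` COMMON — they ARE the model's activity slot: the output functionals
  `outA∕outB (onSub … (actOfCores 𝔠))` depend on them, so R24's g-dependence (small-field thresholds `p(g_k)` read by χ through the
  operator datum `opOf F rawB g U k`; g-dependent BOUNDS) is carried by the operator input and by the letters ∕ budgets, not by a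
  g-indexed model — and the SAME `C₅` (`OutputRateWindow.ne5_of_forall_singleton`).
NOT claimed: any estimate; any value of a letter; that Bałaban's step, cores or letters satisfy a binder; the `Op`-polymorphic η-uniform
twin of §1's assembled face is the same one-liner — on request.  0 sorry; axioms ⊆ {propext, Classical.choice, Quot.sound}.
-/

noncomputable section

open Metric Set MeasureTheory

namespace Summit.QuantumFields.BalabanUV.T4Continuum.B13AssemblyCoresEndArithmetic

open Literature.MathematicalPhysics.QuantumFieldTheory.Balaban1983to89
open Literature.MathematicalPhysics.QuantumFieldTheory.Balaban1983to89.T4OutputRate (Carriers Functional DecayBound NE5)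
open Summit.QuantumFields.BalabanUV.T4Continuum.B13Carriers (TwoRuns)
open Summit.QuantumFields.BalabanUV.T4Continuum.B13OpDatum (OpDatum)
open Summit.QuantumFields.BalabanUV.T4Continuum.B13OpDatumJunctions (opOf RawBounded WeightedEntrywiseRate)
open Summit.QuantumFields.BalabanUV.T4Continuum.B13StepTermLabels (TermIdx InnerLabel)
open Summit.QuantumFields.BalabanUV.T4Continuum.B13InnerData (Bnd)
open Summit.QuantumFields.BalabanUV.T4Continuum.B13HistMeasurable (MeasPotFrame B13HistM)
open Summit.QuantumFields.BalabanUV.T4Continuum.B13TermRep (actMajorant)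
open Summit.QuantumFields.BalabanUV.T4Continuum.B13TermParamGaussianBi (BiCore)
open Summit.QuantumFields.BalabanUV.T4Continuum.B13TermCoreFamily (actOfCores factorCores)
open Summit.QuantumFields.BalabanUV.T4Continuum.B13TermCoreMass (factorMass)
open Summit.QuantumFields.BalabanUV.T4Continuum.B13Base (selfCtr)
open Summit.QuantumFields.BalabanUV.T4Continuum.B13RepresentsOn (AssemblyOn)
open Summit.QuantumFields.BalabanUV.T4Continuum.B13StepOfRecord (Slots assembly step)
open Summit.QuantumFields.BalabanUV.T4Continuum.B13StepOfRecordSub (assemblyOn onSub outA outB)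
open Summit.QuantumFields.BalabanUV.T4Continuum.OutputRateTermwiseLoc (TermBudgetLoc)
open Summit.QuantumFields.BalabanUV.T4Continuum.B13AssemblyCoresEnd (ne5_of_assemblyOn_cores ne5_of_record_onSub_cores)
open Summit.QuantumFields.BalabanUV.T4Continuum.B13StepEndArithmetic (reach_elim_iff smallness_of_gain)
open Summit.QuantumFields.BalabanUV.T4Continuum.OutputRateArithmetic (reach_binders_exists)
open Summit.QuantumFields.BalabanUV.T4Continuum.OutputRateWindow (ne5_of_forall_singleton)

/-! ## §1 Per instance: the letters `ρ₀`, `k₀`, `B` (and `E₁`) eliminated -/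

section OverOp

variable {C : Carriers} {P : MeasPotFrame C} {Op IOp : Type*} [NormedAddCommGroup Op] [NormedSpace ℂ Op] {ι Pol J : Type*}
  {𝒴 : Pol → J → Type*} {dom : ∀ Z j, 𝒴 Z j → C.Dom} {PΛ : Pol → J → Type*} {V : Pol → J → Type*}
  [∀ Z j, MeasurableSpace (PΛ Z j)] [∀ Z j, NormedAddCommGroup (V Z j)] [∀ Z j, InnerProductSpace ℝ (V Z j)]
  [∀ Z j, MeasurableSpace (V Z j)] [∀ Z j, BorelSpace (V Z j)] [∀ Z j, FiniteDimensional ℝ (V Z j)]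

/-- [folklore] **THE (2.14)-FACE WITH FACTOR CORES ON AN ASSEMBLED STEP OVER `Op`, ARITHMETIC LETTERS ELIMINATED** — leaf-08's
`B13AssemblyCoresEnd.ne5_of_assemblyOn_cores` with `hρ₀`∕`hnear`∕`hB`∕`hfirst`∕`hsmall` over `ρ₀, k₀, B` (and `hE₁`) REPLACED by `0 < θ < 1`
and the two strict size inequalities; every other binder BY NAME and unchanged (reading, slice budgets, levels, W1 `OperatorRate δ θ`, W4,
`TermBudgetLoc a G`, rooms, the FACTOR operator letters `hm`∕`hmf`∕`hwB`∕`hN₀`∕`hNf`∕`hqf`, the history radius `hH`, the per-domain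
FACTOR-MASS budget `hmaj`).  `∃ C₅, NE5 (𝔄.outA (𝔄.bHist E₀ cB)) (𝔄.outB (𝔄.bHist E₀ cB)) W κ θ′ C₅`.  NOT a proof of NE5. -/
theorem exists_ne5_of_assemblyOn_cores (𝔄 : AssemblyOn C Op IOp (B13HistM P) ι Pol J)
    (𝔠 : ∀ Z j, BiCore P (dom Z j) Op (PΛ Z j) (V Z j)) (hact : 𝔄.act = actOfCores 𝔠)
    {W : Set (ℕ → ℝ)} {ROp RHist R' H : ℕ → ℝ} {a : ℕ → ι → C.Dom → ℝ} {N₀f mf bf : Pol → J → ℝ}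
    {mstar κ G EA₀ E₀ cA cB δ δ' θ θ' : ℝ}
    (hT : 𝔄.TransportReads W)
    (hbB : 𝔄.SliceBudgetB W κ cB) (hbA : 𝔄.D.SliceBudget (𝔄.stepOn (𝔄.bHist E₀ cB)) W κ cA)
    (hdA : DecayBound (𝔄.outA (𝔄.bHist E₀ cB)) W EA₀ κ) (hdB : DecayBound (𝔄.outB (𝔄.bHist E₀ cB)) W E₀ κ)
    (hop : (𝔄.stepOn (𝔄.bHist E₀ cB)).OperatorRate W δ θ) (hins : (𝔄.stepOn (𝔄.bHist E₀ cB)).InsertionRate W κ E₀ δ' θ)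
    (hbud : TermBudgetLoc a G) (hOp : ∀ k, 𝔄.rOp k ≤ ROp k) (hroom : ∀ k, ROp k < R' k)
    (hHist : ∀ k, 𝔄.bHist E₀ cB k + 𝔄.rHist k ≤ RHist k)
    (hm : 0 < mstar) (hmf : ∀ Z j, mstar ≤ mf Z j) (hwB : ∀ Z j, 0 ≤ (𝔠 Z j).wB) (hN₀ : ∀ Z j, 0 ≤ N₀f Z j)
    (hNf : ∀ k, ∀ g ∈ W, ∀ (U : C.BgB) (X : C.Dom), C.scale X = k → ∀ i, 𝔄.𝒯.Rel k i X → ∀ m : Fin (𝔄.𝒯.len i + 1),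
      (∀ o ∈ ball (selfCtr 𝔄.raw 𝔄.histRef k g U).1 (R' k),
        AEStronglyMeasurable ((factorCores 𝔄.𝒯 𝔠 i m).N o) (factorCores 𝔄.𝒯 𝔠 i m).lam) ∧
      (∀ p, DifferentiableOn ℂ (fun o => (factorCores 𝔄.𝒯 𝔠 i m).N o p) (ball (selfCtr 𝔄.raw 𝔄.histRef k g U).1 (R' k))) ∧
      (∀ o ∈ ball (selfCtr 𝔄.raw 𝔄.histRef k g U).1 (R' k), ∀ p,
        ‖(factorCores 𝔄.𝒯 𝔠 i m).N o p‖ ≤ N₀f (𝔄.𝒯.poly i m) (𝔄.𝒯.lab i m)))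
    (hqf : ∀ k, ∀ g ∈ W, ∀ (U : C.BgB) (X : C.Dom), C.scale X = k → ∀ i, 𝔄.𝒯.Rel k i X → ∀ m : Fin (𝔄.𝒯.len i + 1),
      (∀ o ∈ ball (selfCtr 𝔄.raw 𝔄.histRef k g U).1 (R' k),
        AEStronglyMeasurable (Function.uncurry ((factorCores 𝔄.𝒯 𝔠 i m).q o)) ((factorCores 𝔄.𝒯 𝔠 i m).lam.prod volume)) ∧
      (∀ p v, DifferentiableOn ℂ (fun o => (factorCores 𝔄.𝒯 𝔠 i m).q o p v) (ball (selfCtr 𝔄.raw 𝔄.histRef k g U).1 (R' k))) ∧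
      (∀ o ∈ ball (selfCtr 𝔄.raw 𝔄.histRef k g U).1 (R' k), ∀ p v,
        mf (𝔄.𝒯.poly i m) (𝔄.𝒯.lab i m) * ‖v‖ ^ 2 - bf (𝔄.𝒯.poly i m) (𝔄.𝒯.lab i m) ≤ ((factorCores 𝔄.𝒯 𝔠 i m).q o p v).re))
    (hH : ∀ k, ∀ g ∈ W, ∀ U : C.BgB, ‖(selfCtr 𝔄.raw 𝔄.histRef k g U).2‖ + RHist k ≤ H k)
    (hmaj : ∀ k, ∀ g ∈ W, ∀ (U : C.BgB) (X : C.Dom), C.scale X = k → ∀ i,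
      actMajorant 𝔄.𝒯 𝔄.inc (factorMass 𝔠 N₀f bf mstar (H k)) k X i ≤ a k i X * Real.exp (-(κ * C.d X)))
    (hE₀ : 0 ≤ E₀) (hG : 0 ≤ G) (hcA : 0 ≤ cA) (hcB : 0 ≤ cB) (hδ : 0 ≤ δ) (hδ' : 0 ≤ δ')
    (hθ0 : 0 < θ) (hθ1 : θ < 1) (hθθ' : θ ≤ θ') (hθ'1 : θ' ≤ 1) (hω : 0 < 𝔄.D.ω) (hω1 : 𝔄.D.ω < 1)
    (hh : cA * (EA₀ + E₀) < 1 - 𝔄.D.ω)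
    (hsmall : 𝔄.D.ω + G * cA * (1 - 𝔄.D.ω) / (1 - 𝔄.D.ω - cA * (EA₀ + E₀)) < θ') :
    ∃ C₅, NE5 (𝔄.outA (𝔄.bHist E₀ cB)) (𝔄.outB (𝔄.bHist E₀ cB)) W κ θ' C₅ := by
  obtain ⟨ρ₀, hreach, hρ₀, hs⟩ := (reach_elim_iff (mul_nonneg hG hcA) hω1).mpr ⟨hh, hsmall⟩
  obtain ⟨k₀, B, hB, hnear, hfirst⟩ := reach_binders_exists (D := δ + δ') (add_nonneg hδ hδ') hθ0 hθ1 hreach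
  exact ⟨_, ne5_of_assemblyOn_cores 𝔄 𝔠 hact hT hbB hbA hdA hdB hop hins hbud hOp hroom hHist hm hmf hwB hN₀ hNf hqf hH hmaj hE₀
    one_pos hG hcA hcB hδ hδ' hθ0.le hθθ' hθ'1 hω hω1 hρ₀ hnear hB hfirst (smallness_of_gain hs)⟩

end OverOp

section OnSub

variable {𝔾 : Type} [GaugeGroup 𝔾] {R : TwoRuns 𝔾} {E IOp : Type*} {P : MeasPotFrame R.carriers}
  (S₀ : Slots R E IOp (B13HistM P)) (M : Submodule ℂ (OpDatum E))
  (hMA : ∀ g V k, opOf S₀.F S₀.rawA g V k ∈ M) (hMB : ∀ g U k, opOf S₀.F S₀.rawB g U k ∈ M)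
  {𝒴 : R.carriers.Dom → InnerLabel R.carriers.Dom (Bnd R) → Type*} {dom : ∀ Z ℓ, 𝒴 Z ℓ → R.carriers.Dom}
  {PΛ : R.carriers.Dom → InnerLabel R.carriers.Dom (Bnd R) → Type*} {V : R.carriers.Dom → InnerLabel R.carriers.Dom (Bnd R) → Type*}
  [∀ Z ℓ, MeasurableSpace (PΛ Z ℓ)] [∀ Z ℓ, NormedAddCommGroup (V Z ℓ)] [∀ Z ℓ, InnerProductSpace ℝ (V Z ℓ)]
  [∀ Z ℓ, MeasurableSpace (V Z ℓ)] [∀ Z ℓ, BorelSpace (V Z ℓ)] [∀ Z ℓ, FiniteDimensional ℝ (V Z ℓ)]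
  (𝔠 : ∀ Z ℓ, BiCore P (dom Z ℓ) M (PΛ Z ℓ) (V Z ℓ)) (E₀ cB : ℝ)

/-- [folklore] **THE END OF RECORD WITH (2.14) FACTOR CORES, ARITHMETIC LETTERS ELIMINATED** — leaf-08's
`B13AssemblyCoresEnd.ne5_of_record_onSub_cores S₀ M hMA hMB 𝔠 E₀ cB` with `hρ₀`∕`hnear`∕`hB`∕`hfirst`∕`hsmall` over `ρ₀, k₀, B` (and `hE₁`)
REPLACED by `0 < θ < 1` and the two strict size inequalities; every other binder BY NAME and unchanged (reading, slice budgets ×2, levels of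
`outA∕outB (onSub …)`, the record's `RawBounded` ×2 + `WeightedEntrywiseRate c₁ θ^k` + floor `r₀`, W4, `TermBudgetLoc a G`, rooms, the FACTOR
operator letters on the record's indexing over operator balls in `↥M`, the history radius `hH`, the per-domain FACTOR-MASS budget `hmaj`).
`∃ C₅, NE5 (outA (onSub S₀ M hMA hMB (actOfCores 𝔠)) E₀ cB) (outB (onSub S₀ M hMA hMB (actOfCores 𝔠)) E₀ cB) W κ θ′ C₅`.  NOT a proof of NE5. -/
theorem exists_ne5_of_record_onSub_cores {W : Set (ℕ → ℝ)} {ROp RHist R' H : ℕ → ℝ}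
    {a : ℕ → TermIdx R.carriers.Dom (Bnd R) → R.carriers.Dom → ℝ}
    {N₀f mf bf : R.carriers.Dom → InnerLabel R.carriers.Dom (Bnd R) → ℝ}
    {mstar κ G EA₀ cA c₁ r₀ δ' θ θ' : ℝ}
    (hT : (assembly S₀).TransportReads W)
    (hbB : (assembly S₀).SliceBudgetB W κ cB) (hbA : S₀.D.SliceBudget (step S₀ E₀ cB) W κ cA)
    (hdA : DecayBound (outA (onSub S₀ M hMA hMB (actOfCores 𝔠)) E₀ cB) W EA₀ κ)
    (hdB : DecayBound (outB (onSub S₀ M hMA hMB (actOfCores 𝔠)) E₀ cB) W E₀ κ)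
    (hRA : RawBounded S₀.F (assembly S₀).rawAt W) (hRB : RawBounded S₀.F S₀.rawB W)
    (hwer : WeightedEntrywiseRate S₀.F (assembly S₀).rawAt S₀.rawB W c₁ fun k => θ ^ k) (hfl : ∀ k, r₀ ≤ S₀.rOp k)
    (hins : (step S₀ E₀ cB).InsertionRate W κ E₀ δ' θ)
    (hbud : TermBudgetLoc a G) (hOp : ∀ k, S₀.rOp k ≤ ROp k) (hroom : ∀ k, ROp k < R' k)
    (hHist : ∀ k, (assembly S₀).bHist E₀ cB k + S₀.rHist k ≤ RHist k)
    (hm : 0 < mstar) (hmf : ∀ Z ℓ, mstar ≤ mf Z ℓ) (hwB : ∀ Z ℓ, 0 ≤ (𝔠 Z ℓ).wB) (hN₀ : ∀ Z ℓ, 0 ≤ N₀f Z ℓ)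
    (hNf : ∀ k, ∀ g ∈ W, ∀ (U : R.carriers.BgB) (X : R.carriers.Dom), R.carriers.scale X = k →
      ∀ i, (assembly S₀).𝒯.Rel k i X → ∀ m : Fin ((assembly S₀).𝒯.len i + 1),
      (∀ o ∈ ball (⟨opOf S₀.F S₀.rawB g U k, hMB g U k⟩ : M) (R' k),
        AEStronglyMeasurable ((factorCores (assembly S₀).𝒯 𝔠 i m).N o) (factorCores (assembly S₀).𝒯 𝔠 i m).lam) ∧
      (∀ p, DifferentiableOn ℂ (fun o => (factorCores (assembly S₀).𝒯 𝔠 i m).N o p)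
        (ball (⟨opOf S₀.F S₀.rawB g U k, hMB g U k⟩ : M) (R' k))) ∧
      (∀ o ∈ ball (⟨opOf S₀.F S₀.rawB g U k, hMB g U k⟩ : M) (R' k), ∀ p,
        ‖(factorCores (assembly S₀).𝒯 𝔠 i m).N o p‖ ≤ N₀f ((assembly S₀).𝒯.poly i m) ((assembly S₀).𝒯.lab i m)))
    (hqf : ∀ k, ∀ g ∈ W, ∀ (U : R.carriers.BgB) (X : R.carriers.Dom), R.carriers.scale X = k →
      ∀ i, (assembly S₀).𝒯.Rel k i X → ∀ m : Fin ((assembly S₀).𝒯.len i + 1),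
      (∀ o ∈ ball (⟨opOf S₀.F S₀.rawB g U k, hMB g U k⟩ : M) (R' k),
        AEStronglyMeasurable (Function.uncurry ((factorCores (assembly S₀).𝒯 𝔠 i m).q o))
          ((factorCores (assembly S₀).𝒯 𝔠 i m).lam.prod volume)) ∧
      (∀ p v, DifferentiableOn ℂ (fun o => (factorCores (assembly S₀).𝒯 𝔠 i m).q o p v)
        (ball (⟨opOf S₀.F S₀.rawB g U k, hMB g U k⟩ : M) (R' k))) ∧
      (∀ o ∈ ball (⟨opOf S₀.F S₀.rawB g U k, hMB g U k⟩ : M) (R' k), ∀ p v,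
        mf ((assembly S₀).𝒯.poly i m) ((assembly S₀).𝒯.lab i m) * ‖v‖ ^ 2 - bf ((assembly S₀).𝒯.poly i m) ((assembly S₀).𝒯.lab i m) ≤
          ((factorCores (assembly S₀).𝒯 𝔠 i m).q o p v).re))
    (hH : ∀ k, ∀ g ∈ W, ∀ U : R.carriers.BgB, ‖(assembly S₀).histRef g U k‖ + RHist k ≤ H k)
    (hmaj : ∀ k, ∀ g ∈ W, ∀ (U : R.carriers.BgB) (X : R.carriers.Dom), R.carriers.scale X = k → ∀ i,
      actMajorant (assembly S₀).𝒯 (assembly S₀).inc (factorMass 𝔠 N₀f bf mstar (H k)) k X i ≤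
        a k i X * Real.exp (-(κ * R.carriers.d X)))
    (hE₀ : 0 ≤ E₀) (hG : 0 ≤ G) (hcA : 0 ≤ cA) (hcB : 0 ≤ cB) (hc₁ : 0 ≤ c₁) (hr₀ : 0 < r₀) (hδ' : 0 ≤ δ')
    (hθ0 : 0 < θ) (hθ1 : θ < 1) (hθθ' : θ ≤ θ') (hθ'1 : θ' ≤ 1) (hω : 0 < S₀.D.ω) (hω1 : S₀.D.ω < 1)
    (hh : cA * (EA₀ + E₀) < 1 - S₀.D.ω)
    (hsmall : S₀.D.ω + G * cA * (1 - S₀.D.ω) / (1 - S₀.D.ω - cA * (EA₀ + E₀)) < θ') :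
    ∃ C₅, NE5 (outA (onSub S₀ M hMA hMB (actOfCores 𝔠)) E₀ cB) (outB (onSub S₀ M hMA hMB (actOfCores 𝔠)) E₀ cB) W κ θ' C₅ := by
  obtain ⟨ρ₀, hreach, hρ₀, hs⟩ := (reach_elim_iff (mul_nonneg hG hcA) hω1).mpr ⟨hh, hsmall⟩
  obtain ⟨k₀, B, hB, hnear, hfirst⟩ :=
    reach_binders_exists (D := c₁ / r₀ + δ') (add_nonneg (div_nonneg hc₁ hr₀.le) hδ') hθ0 hθ1 hreach
  exact ⟨_, ne5_of_record_onSub_cores S₀ M hMA hMB 𝔠 E₀ cB hT hbB hbA hdA hdB hRA hRB hwer hfl hins hbud hOp hroom hHist hm hmf hwB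
    hN₀ hNf hqf hH hmaj hE₀ one_pos hG hcA hcB hc₁ hr₀ hδ' hθ0.le hθθ' hθ'1 hω hω1 hρ₀ hnear hB hfirst (smallness_of_gain hs)⟩

end OnSub

/-! ## §2 η-uniform: ONE constant for every pair of runs, slot package, sub-slot, core family, factor letters and window -/

section Uniform

/-- [folklore] **THE END OF RECORD WITH (2.14) FACTOR CORES WITH A CONSTANT UNIFORM IN THE PAIR OF RUNS, THE SUB-SLOT, THE CORES AND
THE LETTERS.**  Fix the SIZES `κ, G, EA₀, E₀, cA, cB, c₁, r₀, δ′`, `0 < θ < 1`, `θ ≤ θ′ ≤ 1`, `0 < ω < 1` subject to `cA(EA₀ + E₀) < 1 − ω`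
and `ω + G·cA·(1 − ω)∕(1 − ω − cA(EA₀ + E₀)) < θ′`.  Then ONE `C₅` serves EVERY pair of runs `R`, measurable potential frame `P`, slot
package `S₀` (`S₀.D.ω = ω`), sub-slot `M ∋` the data of record, label ∕ parameter ∕ fibre types `𝒴, dom, PΛ, V`, core family `𝔠`, factor
letters `m⋆, mf, bf, N₀f`, radius bound `H`, mass weights `a`, radii and window: the displayed binders of leaf-08's
`B13AssemblyCoresEnd.ne5_of_record_onSub_cores` imply `NE5 (outA (onSub S₀ M hMA hMB (actOfCores 𝔠)) E₀ cB) (outB …) W κ θ′ C₅`.  The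
η-uniformity is the quantifier order `∃ C₅, ∀ …`.  NOT a proof of NE5: an implication from displayed binders. -/
theorem uniform_ne5_of_record_onSub_cores {κ G EA₀ E₀ cA cB c₁ r₀ δ' θ θ' ω : ℝ}
    (hE₀ : 0 ≤ E₀) (hG : 0 ≤ G) (hcA : 0 ≤ cA) (hcB : 0 ≤ cB) (hc₁ : 0 ≤ c₁) (hr₀ : 0 < r₀) (hδ' : 0 ≤ δ')
    (hθ0 : 0 < θ) (hθ1 : θ < 1) (hθθ' : θ ≤ θ') (hθ'1 : θ' ≤ 1) (hω : 0 < ω) (hω1 : ω < 1)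
    (hh : cA * (EA₀ + E₀) < 1 - ω) (hsmall : ω + G * cA * (1 - ω) / (1 - ω - cA * (EA₀ + E₀)) < θ') :
    ∃ C₅ : ℝ, ∀ {𝔾 : Type} [GaugeGroup 𝔾] {R : TwoRuns 𝔾} {E IOp : Type*} {P : MeasPotFrame R.carriers}
      (S₀ : Slots R E IOp (B13HistM P)) (M : Submodule ℂ (OpDatum E))
      (hMA : ∀ g V k, opOf S₀.F S₀.rawA g V k ∈ M) (hMB : ∀ g U k, opOf S₀.F S₀.rawB g U k ∈ M)
      {𝒴 : R.carriers.Dom → InnerLabel R.carriers.Dom (Bnd R) → Type*} {dom : ∀ Z ℓ, 𝒴 Z ℓ → R.carriers.Dom}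
      {PΛ : R.carriers.Dom → InnerLabel R.carriers.Dom (Bnd R) → Type*}
      {V : R.carriers.Dom → InnerLabel R.carriers.Dom (Bnd R) → Type*}
      [∀ Z ℓ, MeasurableSpace (PΛ Z ℓ)] [∀ Z ℓ, NormedAddCommGroup (V Z ℓ)] [∀ Z ℓ, InnerProductSpace ℝ (V Z ℓ)]
      [∀ Z ℓ, MeasurableSpace (V Z ℓ)] [∀ Z ℓ, BorelSpace (V Z ℓ)] [∀ Z ℓ, FiniteDimensional ℝ (V Z ℓ)]
      (𝔠 : ∀ Z ℓ, BiCore P (dom Z ℓ) M (PΛ Z ℓ) (V Z ℓ))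
      {W : Set (ℕ → ℝ)} {ROp RHist R' H : ℕ → ℝ} {a : ℕ → TermIdx R.carriers.Dom (Bnd R) → R.carriers.Dom → ℝ}
      {N₀f mf bf : R.carriers.Dom → InnerLabel R.carriers.Dom (Bnd R) → ℝ} {mstar : ℝ},
      S₀.D.ω = ω →
      (assembly S₀).TransportReads W →
      (assembly S₀).SliceBudgetB W κ cB → S₀.D.SliceBudget (step S₀ E₀ cB) W κ cA →
      DecayBound (outA (onSub S₀ M hMA hMB (actOfCores 𝔠)) E₀ cB) W EA₀ κ →
      DecayBound (outB (onSub S₀ M hMA hMB (actOfCores 𝔠)) E₀ cB) W E₀ κ →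
      RawBounded S₀.F (assembly S₀).rawAt W → RawBounded S₀.F S₀.rawB W →
      WeightedEntrywiseRate S₀.F (assembly S₀).rawAt S₀.rawB W c₁ (fun k => θ ^ k) → (∀ k, r₀ ≤ S₀.rOp k) →
      (step S₀ E₀ cB).InsertionRate W κ E₀ δ' θ →
      TermBudgetLoc a G → (∀ k, S₀.rOp k ≤ ROp k) → (∀ k, ROp k < R' k) →
      (∀ k, (assembly S₀).bHist E₀ cB k + S₀.rHist k ≤ RHist k) →
      0 < mstar → (∀ Z ℓ, mstar ≤ mf Z ℓ) → (∀ Z ℓ, 0 ≤ (𝔠 Z ℓ).wB) → (∀ Z ℓ, 0 ≤ N₀f Z ℓ) →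
      (∀ k, ∀ g ∈ W, ∀ (U : R.carriers.BgB) (X : R.carriers.Dom), R.carriers.scale X = k →
        ∀ i, (assembly S₀).𝒯.Rel k i X → ∀ m : Fin ((assembly S₀).𝒯.len i + 1),
        (∀ o ∈ ball (⟨opOf S₀.F S₀.rawB g U k, hMB g U k⟩ : M) (R' k),
          AEStronglyMeasurable ((factorCores (assembly S₀).𝒯 𝔠 i m).N o) (factorCores (assembly S₀).𝒯 𝔠 i m).lam) ∧
        (∀ p, DifferentiableOn ℂ (fun o => (factorCores (assembly S₀).𝒯 𝔠 i m).N o p)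
          (ball (⟨opOf S₀.F S₀.rawB g U k, hMB g U k⟩ : M) (R' k))) ∧
        (∀ o ∈ ball (⟨opOf S₀.F S₀.rawB g U k, hMB g U k⟩ : M) (R' k), ∀ p,
          ‖(factorCores (assembly S₀).𝒯 𝔠 i m).N o p‖ ≤ N₀f ((assembly S₀).𝒯.poly i m) ((assembly S₀).𝒯.lab i m))) →
      (∀ k, ∀ g ∈ W, ∀ (U : R.carriers.BgB) (X : R.carriers.Dom), R.carriers.scale X = k →
        ∀ i, (assembly S₀).𝒯.Rel k i X → ∀ m : Fin ((assembly S₀).𝒯.len i + 1),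
        (∀ o ∈ ball (⟨opOf S₀.F S₀.rawB g U k, hMB g U k⟩ : M) (R' k),
          AEStronglyMeasurable (Function.uncurry ((factorCores (assembly S₀).𝒯 𝔠 i m).q o))
            ((factorCores (assembly S₀).𝒯 𝔠 i m).lam.prod volume)) ∧
        (∀ p v, DifferentiableOn ℂ (fun o => (factorCores (assembly S₀).𝒯 𝔠 i m).q o p v)
          (ball (⟨opOf S₀.F S₀.rawB g U k, hMB g U k⟩ : M) (R' k))) ∧
        (∀ o ∈ ball (⟨opOf S₀.F S₀.rawB g U k, hMB g U k⟩ : M) (R' k), ∀ p v,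
          mf ((assembly S₀).𝒯.poly i m) ((assembly S₀).𝒯.lab i m) * ‖v‖ ^ 2 -
              bf ((assembly S₀).𝒯.poly i m) ((assembly S₀).𝒯.lab i m) ≤
            ((factorCores (assembly S₀).𝒯 𝔠 i m).q o p v).re)) →
      (∀ k, ∀ g ∈ W, ∀ U : R.carriers.BgB, ‖(assembly S₀).histRef g U k‖ + RHist k ≤ H k) →
      (∀ k, ∀ g ∈ W, ∀ (U : R.carriers.BgB) (X : R.carriers.Dom), R.carriers.scale X = k → ∀ i,
        actMajorant (assembly S₀).𝒯 (assembly S₀).inc (factorMass 𝔠 N₀f bf mstar (H k)) k X i ≤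
          a k i X * Real.exp (-(κ * R.carriers.d X))) →
      NE5 (outA (onSub S₀ M hMA hMB (actOfCores 𝔠)) E₀ cB) (outB (onSub S₀ M hMA hMB (actOfCores 𝔠)) E₀ cB) W κ θ' C₅ := by
  obtain ⟨ρ₀, hreach, hρ₀, hs⟩ := (reach_elim_iff (mul_nonneg hG hcA) hω1).mpr ⟨hh, hsmall⟩
  obtain ⟨k₀, B, hB, hnear, hfirst⟩ :=
    reach_binders_exists (D := c₁ / r₀ + δ') (add_nonneg (div_nonneg hc₁ hr₀.le) hδ') hθ0 hθ1 hreach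
  refine ⟨(G / (1 - ρ₀) * (c₁ / r₀) + G / (1 - ρ₀) * δ' + B) * (θ' - ω) / (θ' - (ω + G / (1 - ρ₀) * cA)), ?_⟩
  intro 𝔾 _ R E IOp P S₀ M hMA hMB 𝒴 dom PΛ V _ _ _ _ _ _ 𝔠 W ROp RHist R' H a N₀f mf bf mstar hSω hT hbB hbA hdA hdB hRA hRB hwer
    hfl hins hbud hOp hroom hHist hm hmf hwB hN₀ hNf hqf hH hmaj
  subst hSω
  exact ne5_of_record_onSub_cores S₀ M hMA hMB 𝔠 E₀ cB hT hbB hbA hdA hdB hRA hRB hwer hfl hins hbud hOp hroom hHist hm hmf hwB hN₀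
    hNf hqf hH hmaj hE₀ one_pos hG hcA hcB hc₁ hr₀ hδ' hθ0.le hθθ' hθ'1 hω hω1 hρ₀ hnear hB hfirst (smallness_of_gain hs)

end Uniform

/-! ## §3 Windowwise (R24 × R29′): g-INDEXED factor letters on singleton windows, COMMON cores, the SAME constant -/

section Windowwise

/-- [folklore] **THE END OF RECORD WITH (2.14) FACTOR CORES READ WINDOWWISE WITH g-INDEXED FACTOR LETTERS — ONE η-∕g-UNIFORM CONSTANT.**
§2 with every window-dependent binder supplied at the singleton window `{g}` for each `g ∈ W` and the factor LETTERS g-INDEXED (`m⋆ g`,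
`mf g`, `bf g`, `N₀f g` — where g-dependent BOUNDS on the χ-carrying factors may live, owner R24 —, radius bound `H g`, mass weights `a g`,
COMMON budget `G`), the cores `𝔠` COMMON (they are the model's activity slot; the coupling enters them through the operator input
`opOf F rawB g U k`): `NE5 (outA (onSub S₀ M hMA hMB (actOfCores 𝔠)) E₀ cB) (outB …) W κ θ′ C₅` with the SAME `C₅` for every pair of runs,
slot package, sub-slot, core family, window and coupling (`OutputRateWindow.ne5_of_forall_singleton`; R29′ (a): `∃ C₅` OUTERMOST).
NOT a proof of NE5. -/
theorem uniform_ne5_of_record_onSub_cores_singleton {κ G EA₀ E₀ cA cB c₁ r₀ δ' θ θ' ω : ℝ}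
    (hE₀ : 0 ≤ E₀) (hG : 0 ≤ G) (hcA : 0 ≤ cA) (hcB : 0 ≤ cB) (hc₁ : 0 ≤ c₁) (hr₀ : 0 < r₀) (hδ' : 0 ≤ δ')
    (hθ0 : 0 < θ) (hθ1 : θ < 1) (hθθ' : θ ≤ θ') (hθ'1 : θ' ≤ 1) (hω : 0 < ω) (hω1 : ω < 1)
    (hh : cA * (EA₀ + E₀) < 1 - ω) (hsmall : ω + G * cA * (1 - ω) / (1 - ω - cA * (EA₀ + E₀)) < θ') :
    ∃ C₅ : ℝ, ∀ {𝔾 : Type} [GaugeGroup 𝔾] {R : TwoRuns 𝔾} {E IOp : Type*} {P : MeasPotFrame R.carriers}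
      (S₀ : Slots R E IOp (B13HistM P)) (M : Submodule ℂ (OpDatum E))
      (hMA : ∀ g V k, opOf S₀.F S₀.rawA g V k ∈ M) (hMB : ∀ g U k, opOf S₀.F S₀.rawB g U k ∈ M)
      {𝒴 : R.carriers.Dom → InnerLabel R.carriers.Dom (Bnd R) → Type*} {dom : ∀ Z ℓ, 𝒴 Z ℓ → R.carriers.Dom}
      {PΛ : R.carriers.Dom → InnerLabel R.carriers.Dom (Bnd R) → Type*}
      {V : R.carriers.Dom → InnerLabel R.carriers.Dom (Bnd R) → Type*}
      [∀ Z ℓ, MeasurableSpace (PΛ Z ℓ)] [∀ Z ℓ, NormedAddCommGroup (V Z ℓ)] [∀ Z ℓ, InnerProductSpace ℝ (V Z ℓ)]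
      [∀ Z ℓ, MeasurableSpace (V Z ℓ)] [∀ Z ℓ, BorelSpace (V Z ℓ)] [∀ Z ℓ, FiniteDimensional ℝ (V Z ℓ)]
      (𝔠 : ∀ Z ℓ, BiCore P (dom Z ℓ) M (PΛ Z ℓ) (V Z ℓ))
      {W : Set (ℕ → ℝ)} {ROp RHist R' : ℕ → ℝ} {H : (ℕ → ℝ) → ℕ → ℝ}
      {a : (ℕ → ℝ) → ℕ → TermIdx R.carriers.Dom (Bnd R) → R.carriers.Dom → ℝ}
      {N₀f mf bf : (ℕ → ℝ) → R.carriers.Dom → InnerLabel R.carriers.Dom (Bnd R) → ℝ} {mstar : (ℕ → ℝ) → ℝ},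
      S₀.D.ω = ω →
      (∀ g ∈ W, (assembly S₀).TransportReads {g}) →
      (∀ g ∈ W, (assembly S₀).SliceBudgetB {g} κ cB) → (∀ g ∈ W, S₀.D.SliceBudget (step S₀ E₀ cB) {g} κ cA) →
      (∀ g ∈ W, DecayBound (outA (onSub S₀ M hMA hMB (actOfCores 𝔠)) E₀ cB) {g} EA₀ κ) →
      (∀ g ∈ W, DecayBound (outB (onSub S₀ M hMA hMB (actOfCores 𝔠)) E₀ cB) {g} E₀ κ) →
      (∀ g ∈ W, RawBounded S₀.F (assembly S₀).rawAt {g}) → (∀ g ∈ W, RawBounded S₀.F S₀.rawB {g}) →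
      (∀ g ∈ W, WeightedEntrywiseRate S₀.F (assembly S₀).rawAt S₀.rawB {g} c₁ (fun k => θ ^ k)) → (∀ k, r₀ ≤ S₀.rOp k) →
      (∀ g ∈ W, (step S₀ E₀ cB).InsertionRate {g} κ E₀ δ' θ) →
      (∀ g ∈ W, TermBudgetLoc (a g) G) → (∀ k, S₀.rOp k ≤ ROp k) → (∀ k, ROp k < R' k) →
      (∀ k, (assembly S₀).bHist E₀ cB k + S₀.rHist k ≤ RHist k) →
      (∀ g ∈ W, 0 < mstar g) → (∀ g ∈ W, ∀ Z ℓ, mstar g ≤ mf g Z ℓ) → (∀ Z ℓ, 0 ≤ (𝔠 Z ℓ).wB) →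
      (∀ g ∈ W, ∀ Z ℓ, 0 ≤ N₀f g Z ℓ) →
      (∀ g ∈ W, ∀ k, ∀ g' ∈ ({g} : Set (ℕ → ℝ)), ∀ (U : R.carriers.BgB) (X : R.carriers.Dom), R.carriers.scale X = k →
        ∀ i, (assembly S₀).𝒯.Rel k i X → ∀ m : Fin ((assembly S₀).𝒯.len i + 1),
        (∀ o ∈ ball (⟨opOf S₀.F S₀.rawB g' U k, hMB g' U k⟩ : M) (R' k),
          AEStronglyMeasurable ((factorCores (assembly S₀).𝒯 𝔠 i m).N o) (factorCores (assembly S₀).𝒯 𝔠 i m).lam) ∧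
        (∀ p, DifferentiableOn ℂ (fun o => (factorCores (assembly S₀).𝒯 𝔠 i m).N o p)
          (ball (⟨opOf S₀.F S₀.rawB g' U k, hMB g' U k⟩ : M) (R' k))) ∧
        (∀ o ∈ ball (⟨opOf S₀.F S₀.rawB g' U k, hMB g' U k⟩ : M) (R' k), ∀ p,
          ‖(factorCores (assembly S₀).𝒯 𝔠 i m).N o p‖ ≤ N₀f g ((assembly S₀).𝒯.poly i m) ((assembly S₀).𝒯.lab i m))) →
      (∀ g ∈ W, ∀ k, ∀ g' ∈ ({g} : Set (ℕ → ℝ)), ∀ (U : R.carriers.BgB) (X : R.carriers.Dom), R.carriers.scale X = k →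
        ∀ i, (assembly S₀).𝒯.Rel k i X → ∀ m : Fin ((assembly S₀).𝒯.len i + 1),
        (∀ o ∈ ball (⟨opOf S₀.F S₀.rawB g' U k, hMB g' U k⟩ : M) (R' k),
          AEStronglyMeasurable (Function.uncurry ((factorCores (assembly S₀).𝒯 𝔠 i m).q o))
            ((factorCores (assembly S₀).𝒯 𝔠 i m).lam.prod volume)) ∧
        (∀ p v, DifferentiableOn ℂ (fun o => (factorCores (assembly S₀).𝒯 𝔠 i m).q o p v)
          (ball (⟨opOf S₀.F S₀.rawB g' U k, hMB g' U k⟩ : M) (R' k))) ∧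
        (∀ o ∈ ball (⟨opOf S₀.F S₀.rawB g' U k, hMB g' U k⟩ : M) (R' k), ∀ p v,
          mf g ((assembly S₀).𝒯.poly i m) ((assembly S₀).𝒯.lab i m) * ‖v‖ ^ 2 -
              bf g ((assembly S₀).𝒯.poly i m) ((assembly S₀).𝒯.lab i m) ≤
            ((factorCores (assembly S₀).𝒯 𝔠 i m).q o p v).re)) →
      (∀ g ∈ W, ∀ k, ∀ g' ∈ ({g} : Set (ℕ → ℝ)), ∀ U : R.carriers.BgB, ‖(assembly S₀).histRef g' U k‖ + RHist k ≤ H g k) →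
      (∀ g ∈ W, ∀ k, ∀ g' ∈ ({g} : Set (ℕ → ℝ)), ∀ (U : R.carriers.BgB) (X : R.carriers.Dom), R.carriers.scale X = k → ∀ i,
        actMajorant (assembly S₀).𝒯 (assembly S₀).inc (factorMass 𝔠 (N₀f g) (bf g) (mstar g) (H g k)) k X i ≤
          a g k i X * Real.exp (-(κ * R.carriers.d X))) →
      NE5 (outA (onSub S₀ M hMA hMB (actOfCores 𝔠)) E₀ cB) (outB (onSub S₀ M hMA hMB (actOfCores 𝔠)) E₀ cB) W κ θ' C₅ := by
  obtain ⟨C₅, h⟩ := uniform_ne5_of_record_onSub_cores (κ := κ) hE₀ hG hcA hcB hc₁ hr₀ hδ' hθ0 hθ1 hθθ' hθ'1 hω hω1 hh hsmall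
  refine ⟨C₅, ?_⟩
  intro 𝔾 _ R E IOp P S₀ M hMA hMB 𝒴 dom PΛ V _ _ _ _ _ _ 𝔠 W ROp RHist R' H a N₀f mf bf mstar hSω hT hbB hbA hdA hdB hRA hRB hwer
    hfl hins hbud hOp hroom hHist hm hmf hwB hN₀ hNf hqf hH hmaj
  exact ne5_of_forall_singleton fun g hg =>
    h S₀ M hMA hMB 𝔠 hSω (hT g hg) (hbB g hg) (hbA g hg) (hdA g hg) (hdB g hg) (hRA g hg) (hRB g hg) (hwer g hg) hfl (hins g hg)
      (hbud g hg) hOp hroom hHist (hm g hg) (hmf g hg) hwB (hN₀ g hg) (hNf g hg) (hqf g hg) (hH g hg) (hmaj g hg)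

end Windowwise

end Summit.QuantumFields.BalabanUV.T4Continuum.B13AssemblyCoresEndArithmetic

end
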